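/-
VALUE = THEOREM, NOT summit progress (cell b2b-lgcu-borel, gen 22); crux 14079 untouched.
-/
import Mathlib
import Summits.MatrixMultiplication.MatrixMultiplication.Theorems.SubgroupIdentityDesigns.Negative.AdmissibilityPrinciple

/-!
# Monomial reflections: the `p`-free family `G(p-1,p-1,3) ⊕ 1` lies in no member

VALUE = THEOREM (every odd `p`, every `m ≥ 3`, every `ε`), NOT summit progress.

The MONOMIAL REFLECTION `W_{ij}(a) = 1 + c vᵀ` (`v = -e_i + a e_j`, `c = e_i - a⁻¹ e_j`,
`a ∈ 𝔽_pˣ`, `i ≠ j`) swaps the coordinate axes `i, j` with weights `a^{∓1}`, has determinant `-1`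
and fixes the hyperplane `u_i = a u_j` pointwise.  For three distinct coordinates `i₀, i₁, i₂`
(`m ≥ 3`) every vector of `𝔽_p^m` has two of the three coordinates both zero or both non-zero, hence
lies on one of the hyperplanes `u_i = a u_j` (`a ≠ 0`): the `3(p-1)` monomial reflections of the
three planes form a DETERMINANT COVER, so by `AdmissibilityPrinciple.crux_det_cover_not_le_member`
(`p` odd) **no member of a triple carrying a level-one identity design contains them**
(`no_design_of_swapRefl_mem₁/₂/₃`).  They generate the imprimitive reflection group
`G(p-1,p-1,3) ⊕ 1_{m-3} = {monomial on ⟨e_{i₀},e_{i₁},e_{i₂}⟩, product of the non-zero entries = 1}`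
of order `6(p-1)²`, PRIME TO `p` and inside the member window for every `m ≥ 3`; at `p = 5` it is
the minimal non-carrier class `96-A` of the generation-21 GAP scan (ORACLE-g21 §G21-24; identified in
ORACLE-g22 §G22-3) — so that class is an instance of an all-`p`, all-`m` family.  Contrast
`AdmissibilityPrinciple.reflFamily` (the `p + 1` reflections of ONE plane, generating a group of
order `4p`): here the group is `p`-free and needs three coordinates (in a plane the vectors with
exactly one zero coordinate escape).

HONEST SCOPE.  Configuration exclusion; no `(p,m,ε)` cell is emptied.
-/

set_option linter.dupNamespace false

noncomputable section

open scoped BigOperators Classical Matrix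

namespace Summit.MatrixMultiplication.MatrixMultiplication.Theorems.SubgroupIdentityDesigns.Negative
namespace MonomialReflections

open Summit.MatrixMultiplication.MatrixMultiplication.Theorems.LieRankDesigns.Negative (GLm Mat)
open AdmissibilityPrinciple (crux_det_cover_not_le_member)

variable {p m : ℕ} [hp : Fact p.Prime]

/-! ## Dyads `1 + c vᵀ` -/

/-- The dyad perturbation of the identity `1 + c vᵀ`. -/
def dyadMat (c v : Fin m → ZMod p) : Mat p m := 1 + Matrix.vecMulVec c v

/-- `det (1 + c vᵀ) = 1 + v · c` (matrix determinant lemma). -/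
theorem det_dyadMat (c v : Fin m → ZMod p) : (dyadMat c v).det = 1 + v ⬝ᵥ c := by
  rw [dyadMat, Matrix.vecMulVec_eq Unit, Matrix.det_one_add_replicateCol_mul_replicateRow]

/-- `(1 + c vᵀ) u = u + (v · u) c`. -/
theorem dyadMat_mulVec (c v u : Fin m → ZMod p) : dyadMat c v *ᵥ u = u + (v ⬝ᵥ u) • c := by
  rw [dyadMat, Matrix.add_mulVec, Matrix.one_mulVec]
  congr 1
  ext k
  simp only [Matrix.mulVec, dotProduct, Matrix.vecMulVec_apply, Pi.smul_apply, smul_eq_mul]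
  rw [Finset.sum_mul]
  exact Finset.sum_congr rfl fun j _ => by ring

/-- The dyad as an element of `GL_m(𝔽_p)` when `1 + v · c ≠ 0`. -/
def dyad (c v : Fin m → ZMod p) (h : 1 + v ⬝ᵥ c ≠ 0) : GLm p m :=
  Matrix.GeneralLinearGroup.mkOfDetNeZero (dyadMat c v) (by rwa [det_dyadMat])

/-- Underlying matrix of `dyad`. -/
theorem coe_dyad (c v : Fin m → ZMod p) (h : 1 + v ⬝ᵥ c ≠ 0) :
    ((dyad c v h : GLm p m) : Mat p m) = dyadMat c v := rfl

/-! ## The monomial reflections `W_{ij}(a)` -/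

section Swap

variable {i j : Fin m}

/-- `v = -e_i + a e_j`. -/
def swv (i j : Fin m) (a : ZMod p) : Fin m → ZMod p := -Pi.single i 1 + a • Pi.single j 1

/-- `c = e_i - a⁻¹ e_j`. -/
def swc (i j : Fin m) (a : ZMod p) : Fin m → ZMod p := Pi.single i 1 - a⁻¹ • Pi.single j 1

/-- `v · u = -u_i + a u_j`. -/
theorem swv_dotProduct (a : ZMod p) (u : Fin m → ZMod p) : swv i j a ⬝ᵥ u = -u i + a * u j := by
  simp [swv, add_dotProduct, smul_dotProduct]

/-- `v · c = -2` (`i ≠ j`, `a ≠ 0`). -/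
theorem swv_dotProduct_swc (hij : i ≠ j) {a : ZMod p} (ha : a ≠ 0) :
    swv i j a ⬝ᵥ swc i j a = -2 := by
  rw [swv_dotProduct]
  simp only [swc, Pi.sub_apply, Pi.smul_apply, smul_eq_mul, Pi.single_apply,
    if_neg hij, if_neg hij.symm, if_true, mul_zero, sub_zero, zero_sub, mul_neg, mul_one,
    mul_inv_cancel₀ ha]
  norm_num

/-- **The monomial reflection `W_{ij}(a)`** (`i ≠ j`, `a ≠ 0`): `e_j ↦ a e_i`, `e_i ↦ a⁻¹ e_j`,
`e_k ↦ e_k` otherwise. -/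
def swapRefl (hij : i ≠ j) {a : ZMod p} (ha : a ≠ 0) : GLm p m :=
  dyad (swc i j a) (swv i j a) (by
    rw [swv_dotProduct_swc hij ha]; norm_num)

/-- `det W_{ij}(a) = -1`. -/
theorem det_swapRefl (hij : i ≠ j) {a : ZMod p} (ha : a ≠ 0) :
    Matrix.GeneralLinearGroup.det (swapRefl hij ha : GLm p m) = -1 :=
  Units.ext (by
    rw [Matrix.GeneralLinearGroup.val_det_apply, swapRefl, coe_dyad, det_dyadMat,
      swv_dotProduct_swc hij ha, Units.val_neg, Units.val_one]
    norm_num)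

/-- `W_{ij}(a)` fixes the hyperplane `u_i = a u_j` pointwise. -/
theorem swapRefl_smul_of_eq (hij : i ≠ j) {a : ZMod p} (ha : a ≠ 0) (u : Fin m → ZMod p)
    (hu : u i = a * u j) : swapRefl hij ha • u = u := by
  show (dyadMat (swc i j a) (swv i j a)) *ᵥ u = u
  rw [dyadMat_mulVec, swv_dotProduct, hu, neg_add_cancel, zero_smul, add_zero]

end Swap

/-! ## The determinant cover and the exclusion -/

section Cover

variable {i₀ i₁ i₂ : Fin m}

/-- **DETERMINANT COVER.**  If `K` contains the `3(p-1)` monomial reflections of three distinct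
coordinates then every vector is fixed by an element of `K` of determinant `-1`. -/
theorem swap_cover (h₀₁ : i₀ ≠ i₁) (h₁₂ : i₁ ≠ i₂) (h₀₂ : i₀ ≠ i₂) {K : Subgroup (GLm p m)}
    (hK : ∀ a : ZMod p, ∀ ha : a ≠ 0,
      swapRefl h₀₁ ha ∈ K ∧ swapRefl h₁₂ ha ∈ K ∧ swapRefl h₀₂ ha ∈ K)
    (u : Fin m → ZMod p) :
    ∃ k : K, k • u = u ∧ Matrix.GeneralLinearGroup.det (k : GLm p m) = -1 := by
  have key : ∀ {i j : Fin m} (hij : i ≠ j) (a : ZMod p) (ha : a ≠ 0),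
      swapRefl hij ha ∈ K → u i = a * u j →
      ∃ k : K, k • u = u ∧ Matrix.GeneralLinearGroup.det (k : GLm p m) = -1 :=
    fun hij a ha hk hu => ⟨⟨_, hk⟩, swapRefl_smul_of_eq hij ha u hu, det_swapRefl hij ha⟩
  by_cases h0 : u i₀ = 0 <;> by_cases h1 : u i₁ = 0
  · exact key h₀₁ 1 one_ne_zero (hK 1 one_ne_zero).1 (by rw [h0, h1, mul_zero])
  · by_cases h2 : u i₂ = 0
    · exact key h₀₂ 1 one_ne_zero (hK 1 one_ne_zero).2.2 (by rw [h0, h2, mul_zero])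
    · exact key h₁₂ (u i₁ / u i₂) (div_ne_zero h1 h2) (hK _ _).2.1
        (by rw [div_mul_cancel₀ _ h2])
  · by_cases h2 : u i₂ = 0
    · exact key h₁₂ 1 one_ne_zero (hK 1 one_ne_zero).2.1 (by rw [h1, h2, mul_zero])
    · exact key h₀₂ (u i₀ / u i₂) (div_ne_zero h0 h2) (hK _ _).2.2
        (by rw [div_mul_cancel₀ _ h2])
  · exact key h₀₁ (u i₀ / u i₁) (div_ne_zero h0 h1) (hK _ _).1 (by rw [div_mul_cancel₀ _ h1])

variable {H₁ H₂ H₃ : Subgroup (GLm p m)}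

/-- **THE MONOMIAL REFLECTIONS OF THREE COORDINATES LIE IN NO MEMBER — `H₁`** (`p` odd, every
`m ≥ 3`, every `ε`; no TPP): the design clause of `SubgroupIdentityDesigns` at `k = 1` fails. -/
theorem no_design_of_swapRefl_mem₁ (hp2 : p ≠ 2) (h₀₁ : i₀ ≠ i₁) (h₁₂ : i₁ ≠ i₂) (h₀₂ : i₀ ≠ i₂)
    (hW : ∀ a : ZMod p, ∀ ha : a ≠ 0,
      swapRefl h₀₁ ha ∈ H₁ ∧ swapRefl h₁₂ ha ∈ H₁ ∧ swapRefl h₀₂ ha ∈ H₁) :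
    ¬ ∃ c : Mat p m → ℂ, (∀ M, 1 < M.rank → c M = 0) ∧
      (∑ M, c M * ZMod.stdAddChar (Matrix.trace (M * ((1 : GLm p m) : Mat p m)))) = 1 ∧
      ∀ a ∈ H₁, ∀ b ∈ H₂, ∀ g ∈ H₃, a * b * g ≠ 1 →
        (∑ M, c M * ZMod.stdAddChar (Matrix.trace (M * ((a * b * g : GLm p m) : Mat p m)))) = 0 :=
  fun hdes => (crux_det_cover_not_le_member hp2 hdes (swap_cover h₀₁ h₁₂ h₀₂ hW)).1 le_rfl

/-- **… — `H₂`.** -/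
theorem no_design_of_swapRefl_mem₂ (hp2 : p ≠ 2) (h₀₁ : i₀ ≠ i₁) (h₁₂ : i₁ ≠ i₂) (h₀₂ : i₀ ≠ i₂)
    (hW : ∀ a : ZMod p, ∀ ha : a ≠ 0,
      swapRefl h₀₁ ha ∈ H₂ ∧ swapRefl h₁₂ ha ∈ H₂ ∧ swapRefl h₀₂ ha ∈ H₂) :
    ¬ ∃ c : Mat p m → ℂ, (∀ M, 1 < M.rank → c M = 0) ∧
      (∑ M, c M * ZMod.stdAddChar (Matrix.trace (M * ((1 : GLm p m) : Mat p m)))) = 1 ∧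
      ∀ a ∈ H₁, ∀ b ∈ H₂, ∀ g ∈ H₃, a * b * g ≠ 1 →
        (∑ M, c M * ZMod.stdAddChar (Matrix.trace (M * ((a * b * g : GLm p m) : Mat p m)))) = 0 :=
  fun hdes => (crux_det_cover_not_le_member hp2 hdes (swap_cover h₀₁ h₁₂ h₀₂ hW)).2.1 le_rfl

/-- **… — `H₃`.** -/
theorem no_design_of_swapRefl_mem₃ (hp2 : p ≠ 2) (h₀₁ : i₀ ≠ i₁) (h₁₂ : i₁ ≠ i₂) (h₀₂ : i₀ ≠ i₂)
    (hW : ∀ a : ZMod p, ∀ ha : a ≠ 0,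
      swapRefl h₀₁ ha ∈ H₃ ∧ swapRefl h₁₂ ha ∈ H₃ ∧ swapRefl h₀₂ ha ∈ H₃) :
    ¬ ∃ c : Mat p m → ℂ, (∀ M, 1 < M.rank → c M = 0) ∧
      (∑ M, c M * ZMod.stdAddChar (Matrix.trace (M * ((1 : GLm p m) : Mat p m)))) = 1 ∧
      ∀ a ∈ H₁, ∀ b ∈ H₂, ∀ g ∈ H₃, a * b * g ≠ 1 →
        (∑ M, c M * ZMod.stdAddChar (Matrix.trace (M * ((a * b * g : GLm p m) : Mat p m)))) = 0 :=
  fun hdes => (crux_det_cover_not_le_member hp2 hdes (swap_cover h₀₁ h₁₂ h₀₂ hW)).2.2 le_rfl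

end Cover

end MonomialReflections
end Summit.MatrixMultiplication.MatrixMultiplication.Theorems.SubgroupIdentityDesigns.Negative
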